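import Literature.Analysis.FluidPDE.BallRadialMoments
import Mathlib.MeasureTheory.Integral.IntervalIntegral.Basic
import HarnessLib

/-!
# Crux `HistoryTailL` (stmt-QuantumFields-19936 ∕ LINE 25 item stmt-QuantumFields-23533), S1″ (TM) road, brick (TM-F1)(3) «THE LEBESGUE RADIAL
# PUSH-FORWARD ON `E³` ABOUT ANY CENTRE»: `∫_{B_R(y)} h(dist(x,y)) dx = 4π·∫₀^R r²·h(r) dr` (open or closed ball), plus the integrability transfer
# `h(dist(·,y)) ∈ L¹(B_R(y)) ↔ r²h ∈ L¹(0,R)` — by TRANSLATION from the origin-centred formula already in the tree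
# (lit ✓`Literature.Analysis.FluidPDE.integral_ball_radial_fin_three`, [Folland1999 Thm 2.49]) and Mathlib's ✓`integrableOn_fun_norm_addHaar`

Cell `ym3-torus` (YM ladder rung R3 = continuum SU(2) Yang–Mills on T³ — a RUNG, NOT the Clay problem: not d = 4, not infinite volume, not a mass
gap); width seat `ym3-torus-px22` g7, second hand on px3 g9's (TM-F) «DENSITY CAP `Θ ≤ 3π` for minimizing tangent maps `ℝ³ → S³`» (its step (3):
for a radial test function `ζ = F(dist(x,y))` the stability inequality's right side is `∫_{B_ρ(y)}|∇ζ|² = 4π∫₀^ρ r²F′²`, in the `k (dist x y)`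
letters of ✓`…MonotonicityEqualityLetters.setIntegral_radial_mul_eq_of_ball_linear`).  Helper `--supports stmt-QuantumFields-23533`; THEOREMS
ONLY (0 `def`, 0 `sorry`, default heartbeats); imports lit ✓`BallRadialMoments` (USED, not restated) + Mathlib; `h : ℝ → ℝ` is ARBITRARY in the
identities (both sides are junk-consistent Bochner integrals of one push-forward measure).

WHAT IS PROVED (ns `…Theorems.PoincareLipschitzRadialLebesguePushforward`), `E³ := EuclideanSpace ℝ (Fin 3)`:
* §1 translation letters `preimage_sub_ball`, `setIntegral_ball_norm_sub_eq_setIntegral_ball_zero`; ★★★`setIntegral_ball_norm_sub_eq` (`0 ≤ R`: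
  `∫_{ball y R} h ‖x − y‖ = 4π·∫ r in 0..R, r²·h r`), ★★★`setIntegral_ball_dist_eq` (same with `h (dist x y)`), `setIntegral_ball_dist_eq_Ioo` (set-integral
  spelling on `Ioo 0 R`), ★`setIntegral_closedBall_dist_eq` (closed ball: the sphere is null).
* §2 ★`integrableOn_ball_dist_iff` (`IntegrableOn (fun x => h (dist x y)) (ball y R) ↔ IntegrableOn (fun r => r ^ 2 * h r) (Ioo 0 R)`),
  `integrableOn_ball_dist_of_continuousOn` (`ContinuousOn h (Icc 0 R)` suffices).
HONEST SCOPE.  Measure-theoretic bookkeeping; NOTHING here proves (TM-F), (TM), (C), S1″, K1, `MeanDeviationL`, `BlockLipschitzL` or `HistoryTailL`.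
YM₃ on T³ is rung R3, not Clay; YM gap NOT proved; no summit statement is proved here.

References: G. B. Folland, Real Analysis (1999), Thm 2.49 (polar coordinates) [Folland1999]; L. Simon, Theorems on Regularity and Singularity of
Energy Minimizing Maps (1996), §2.4–§2.5 (radial test functions) [Simon1996].
-/

set_option autoImplicit false

noncomputable section

open MeasureTheory Metric Set Real
open scoped BigOperators

namespace Summit.QuantumFields.YangMills.Theorems.PoincareLipschitzRadialLebesguePushforward

open Literature.Analysis.FluidPDE (integral_ball_radial_fin_three)

/-! ## §1 The ball formula about any centre -/

/-- The translate `x ↦ x − y` pulls the ball about `0` back to the ball about `y`. [folklore] -/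
theorem preimage_sub_ball (y : EuclideanSpace ℝ (Fin 3)) (R : ℝ) :
    (fun x : EuclideanSpace ℝ (Fin 3) => x - y) ⁻¹' (ball 0 R) = ball y R := by
  ext x
  simp [dist_eq_norm]

/-- Translation: `∫_{ball y R} h ‖x − y‖ dx = ∫_{ball 0 R} h ‖x‖ dx` (Lebesgue measure is translation invariant). [folklore] -/
theorem setIntegral_ball_norm_sub_eq_setIntegral_ball_zero (y : EuclideanSpace ℝ (Fin 3)) (R : ℝ) (h : ℝ → ℝ) :
    ∫ x in ball y R, h ‖x - y‖ = ∫ x in ball (0 : EuclideanSpace ℝ (Fin 3)) R, h ‖x‖ := by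
  have hmp : MeasurePreserving (fun x : EuclideanSpace ℝ (Fin 3) => x - y) volume volume :=
    measurePreserving_sub_right volume y
  have hemb : MeasurableEmbedding (fun x : EuclideanSpace ℝ (Fin 3) => x - y) :=
    (MeasurableEquiv.subRight y).measurableEmbedding
  have H := hmp.setIntegral_preimage_emb hemb (fun x : EuclideanSpace ℝ (Fin 3) => h ‖x‖) (ball 0 R)
  rw [preimage_sub_ball] at H
  exact H

/-- ★★★ **RADIAL INTEGRATION OVER A BALL OF `E³` ABOUT ANY CENTRE**, norm letters: `∫_{ball y R} h(‖x − y‖) dx = 4π·∫₀^R r²·h(r) dr`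
(`0 ≤ R`, `h` arbitrary). [cite: Folland1999, Thm. 2.49] -/
theorem setIntegral_ball_norm_sub_eq (y : EuclideanSpace ℝ (Fin 3)) {R : ℝ} (hR : 0 ≤ R) (h : ℝ → ℝ) :
    ∫ x in ball y R, h ‖x - y‖ = 4 * π * ∫ r in (0:ℝ)..R, r ^ 2 * h r := by
  rw [setIntegral_ball_norm_sub_eq_setIntegral_ball_zero, integral_ball_radial_fin_three h hR]

/-- ★★★ The same in `dist` letters: `∫_{ball y R} h(dist(x,y)) dx = 4π·∫₀^R r²·h(r) dr` (`0 ≤ R`). [cite: Folland1999, Thm. 2.49] -/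
theorem setIntegral_ball_dist_eq (y : EuclideanSpace ℝ (Fin 3)) {R : ℝ} (hR : 0 ≤ R) (h : ℝ → ℝ) :
    ∫ x in ball y R, h (dist x y) = 4 * π * ∫ r in (0:ℝ)..R, r ^ 2 * h r := by
  simp_rw [dist_eq_norm]
  exact setIntegral_ball_norm_sub_eq y hR h

/-- The set-integral spelling on `Ioo 0 R`: `∫_{ball y R} h(dist(x,y)) dx = 4π·∫_{(0,R)} r²·h(r) dr` (`0 ≤ R`). [cite: Folland1999, Thm. 2.49] -/
theorem setIntegral_ball_dist_eq_Ioo (y : EuclideanSpace ℝ (Fin 3)) {R : ℝ} (hR : 0 ≤ R) (h : ℝ → ℝ) :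
    ∫ x in ball y R, h (dist x y) = 4 * π * ∫ r in Ioo (0:ℝ) R, r ^ 2 * h r := by
  rw [setIntegral_ball_dist_eq y hR, intervalIntegral.integral_of_le hR, setIntegral_congr_set Ioo_ae_eq_Ioc]

/-- In `E³` a closed ball and the open ball agree a.e. (the sphere is Lebesgue-null). [folklore] -/
theorem ball_ae_eq_closedBall (y : EuclideanSpace ℝ (Fin 3)) (R : ℝ) :
    (ball y R : Set (EuclideanSpace ℝ (Fin 3))) =ᵐ[volume] closedBall y R := by
  refine ae_eq_of_subset_of_measure_ge ball_subset_closedBall ?_ measurableSet_ball.nullMeasurableSet measure_closedBall_lt_top.ne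
  rw [Measure.addHaar_closedBall_eq_addHaar_ball]

/-- ★ Closed-ball form: `∫_{closedBall y R} h(dist(x,y)) dx = 4π·∫₀^R r²·h(r) dr` (`0 ≤ R`). [cite: Folland1999, Thm. 2.49] -/
theorem setIntegral_closedBall_dist_eq (y : EuclideanSpace ℝ (Fin 3)) {R : ℝ} (hR : 0 ≤ R) (h : ℝ → ℝ) :
    ∫ x in closedBall y R, h (dist x y) = 4 * π * ∫ r in (0:ℝ)..R, r ^ 2 * h r := by
  rw [← setIntegral_congr_set (ball_ae_eq_closedBall y R), setIntegral_ball_dist_eq y hR]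

/-! ## §2 Integrability transfer -/

/-- ★ **INTEGRABILITY TRANSFER**: `x ↦ h(dist(x,y))` is integrable on `ball y R` iff `r ↦ r²·h(r)` is integrable on `(0,R)`
(translation + Mathlib ✓`integrableOn_fun_norm_addHaar` at `dim = 3`). [folklore] -/
theorem integrableOn_ball_dist_iff (y : EuclideanSpace ℝ (Fin 3)) (R : ℝ) (h : ℝ → ℝ) :
    IntegrableOn (fun x : EuclideanSpace ℝ (Fin 3) => h (dist x y)) (ball y R) volume ↔
      IntegrableOn (fun r : ℝ => r ^ 2 * h r) (Ioo 0 R) volume := by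
  have hmp : MeasurePreserving (fun x : EuclideanSpace ℝ (Fin 3) => x - y) volume volume :=
    measurePreserving_sub_right volume y
  have hemb : MeasurableEmbedding (fun x : EuclideanSpace ℝ (Fin 3) => x - y) :=
    (MeasurableEquiv.subRight y).measurableEmbedding
  have H := hmp.integrableOn_comp_preimage hemb (f := fun x : EuclideanSpace ℝ (Fin 3) => h ‖x‖) (s := ball 0 R)
  rw [preimage_sub_ball] at H
  have H' : IntegrableOn (fun x : EuclideanSpace ℝ (Fin 3) => h (dist x y)) (ball y R) volume ↔
      IntegrableOn (fun x : EuclideanSpace ℝ (Fin 3) => h ‖x‖) (ball 0 R) volume := by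
    simp_rw [dist_eq_norm]; exact H
  rw [H', integrableOn_fun_norm_addHaar, finrank_euclideanSpace_fin]
  simp only [smul_eq_mul, Nat.add_one_sub_one]

/-- Continuity on `[0,R]` suffices: `ContinuousOn h (Icc 0 R) ⇒ IntegrableOn (x ↦ h(dist(x,y))) (ball y R)`. [folklore] -/
theorem integrableOn_ball_dist_of_continuousOn (y : EuclideanSpace ℝ (Fin 3)) {R : ℝ} {h : ℝ → ℝ}
    (hh : ContinuousOn h (Icc 0 R)) :
    IntegrableOn (fun x : EuclideanSpace ℝ (Fin 3) => h (dist x y)) (ball y R) volume := by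
  rw [integrableOn_ball_dist_iff]
  exact (((continuousOn_id.pow 2).mul hh).integrableOn_compact isCompact_Icc).mono_set Ioo_subset_Icc_self

end Summit.QuantumFields.YangMills.Theorems.PoincareLipschitzRadialLebesguePushforward

end
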